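import Summits.HubbardSuperconductivity.HubbardSuperconductivity.Theorems.ThermalWedgeTwSeededRungSectorGibbs
import Summits.HubbardSuperconductivity.HubbardSuperconductivity.Theorems.ThermalWedgeTwSeededEnsembleEquivalenceEvenSectorMin
import Summits.HubbardSuperconductivity.HubbardSuperconductivity.Theorems.ThermalWedgeTwSeededEnsembleEquivalencePairFieldSinglet
import Literature.MathematicalPhysics.QuantumLattice.DWaveSourceLeeYang
import Literature.MathematicalPhysics.QuantumLattice.DWaveSourceFreePressure

/-!
# Crux `TwSeededEnsembleEquivalence` (stmt-HubbardSuperconductivity-1698), line `exposed-density-duality`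
# (thermal member, skeleton v11) — stub `stub_sectorWeightBasics`

Particle-number SECTOR WEIGHTS of the seeded grand-canonical torus
`K_L(μ) = hubbardTorusWith 2 L 1 U μ − (g/L²)P_L`, `P_L = (pairField d L)ᴴ(pairField d L)`:
`W_L(N; β, μ) = Σ_{|s| = N} Re (e^{−βK_L(μ)})_{ss}` (occupation basis `|s⟩`, `s : Finset (Orb Λ_L)`).

* (a) `Re Z(β, K_L(μ)) = Σ_{N ≤ 2L²} W_L(N; β, μ)` (the trace in the occupation basis regrouped by `|s|`);
* (b) the `μ`-TILT `W_L(N; β, μ') = e^{β(μ'−μ)N} W_L(N; β, μ)`: `K_L(μ') = K_L(μ) − (μ'−μ)N̂` with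
  `N̂ = diagonal |s|` commuting with `K_L(μ)` (block diagonal in `(N↑, N↓)`), so
  `e^{−βK_L(μ')} = e^{−βK_L(μ)} · diagonal (e^{β(μ'−μ)|s|})` (`Matrix.exp_add_of_commute`, `Matrix.exp_diagonal`);
* (c) `0 < W_L(N; β, μ)` for `N ≤ 2L²` (diagonal entries of the positive definite `e^{−βK}`, nonempty sector);
* (d) the PROBABILISTIC NORMAL FORM of the canonical/grand-canonical defect on the even sectors `N = 2n ≤ 2L²`:
  `β(E_V − μN) + log Re Z ≤ L² log 4 + log (Re Z / W_L(N; β, μ))`, `E_V = minEnergyOn Hcan (szSector N 0)`,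
  `Hcan = hubbardTorus 2 L 1 U − (g/L²)P_L`: the tree's sector entropy bound
  `re_trace_projMatrix_mul_gibbsWeight_le` on the coordinate subspace `nParticleSubmodule N` (whose orthogonal
  projection is the diagonal indicator of `|s| = N`, so that `Re tr (P e^{−βK}) = W_L(N)`), the Rayleigh shift
  `minEnergyOn K_L(μ) ≥ minEnergyOn Hcan − μN` on that subspace, the landed `stub_evenSectorMin` /
  `stub_pairFieldSinglet` (the `S^z = 0` sector realises the `N`-sector minimum) and `dim ≤ |Fock| = 4^{L²}`.

All four are finite-dimensional folklore (Bratteli–Robinson II §5.3.1; Tasaki (2020) App. A).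
-/

set_option linter.dupNamespace false

namespace Summit.HubbardSuperconductivity.HubbardSuperconductivity.Theorems.TwSeededEnsembleEquivalence.ThermalDuality

open Matrix Filter Topology Finset Literature.MathematicalPhysics.QuantumLattice
open Summit.HubbardSuperconductivity.HubbardSuperconductivity.Theorems.TwSeededEnsembleEquivalence.ExposedDensity
open scoped ComplexOrder Matrix.Norms.L2Operator

noncomputable section

section Helpers

variable (L : ℕ) [NeZero L]

omit [NeZero L] in
/-- An occupation-basis vector `|s⟩` with `|s| = N` lies in the `N`-particle sector. [folklore] -/
private theorem single_mem_nParticleSubmodule {N : ℕ} {s : Finset (Orb (FermionTorus 2 L))}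
    (hs : s.card = N) :
    (Pi.single s (1 : ℂ) : Fock (Orb (FermionTorus 2 L))) ∈
      nParticleSubmodule (ι := Orb (FermionTorus 2 L)) N := by
  intro t ht
  exact Pi.single_eq_of_ne (fun h => ht (by rw [h]; exact hs)) _

omit [NeZero L] in
/-- The orthogonal projection onto the coordinate subspace `nParticleSubmodule N` of the Fock space
is the diagonal indicator of `|s| = N` (both fix `|s⟩` when `|s| = N` and annihilate it otherwise).
[folklore] -/
private theorem projMatrix_nParticleSubmodule (N : ℕ) :
    projMatrix ((nParticleSubmodule (ι := Orb (FermionTorus 2 L)) N).map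
        ((WithLp.linearEquiv 2 ℂ (Finset (Orb (FermionTorus 2 L)) → ℂ)).symm :
          (Finset (Orb (FermionTorus 2 L)) → ℂ) →ₗ[ℂ]
            EuclideanSpace ℂ (Finset (Orb (FermionTorus 2 L))))) =
      diagonal (fun s : Finset (Orb (FermionTorus 2 L)) => if s.card = N then (1 : ℂ) else 0) := by
  refine Matrix.ext_of_mulVec_single fun t => ?_
  rw [diagonal_mulVec_single, mul_one]
  by_cases ht : t.card = N
  · rw [projMatrix_map_mulVec_of_mem _ (single_mem_nParticleSubmodule L ht), if_pos ht]
  · rw [projMatrix_map_mulVec_eq_zero_of_orthogonal _ fun w hw => ?_, if_neg ht, Pi.single_zero]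
    have hw' : IsNParticle N w := hw
    rw [dotProduct_single, mul_one, Pi.star_apply, hw' t ht, star_zero]

/-- `K_L(μ)` commutes with every diagonal function of the particle number `|s|` (it is block
diagonal in `(N↑, N↓)`, `tw_preservesSectors_seededGC`). [folklore] -/
private theorem diagonal_card_mul_seededGC (U μ g : ℝ) (f : ℕ → ℂ) :
    diagonal (fun s : Finset (Orb (FermionTorus 2 L)) => f s.card) *
        (hubbardTorusWith 2 L 1 U μ - ((g / (L : ℝ) ^ 2 : ℝ) : ℂ) •
          ((pairField dWaveFormFactor L)ᴴ * pairField dWaveFormFactor L)) =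
      (hubbardTorusWith 2 L 1 U μ - ((g / (L : ℝ) ^ 2 : ℝ) : ℂ) •
          ((pairField dWaveFormFactor L)ᴴ * pairField dWaveFormFactor L)) *
        diagonal (fun s : Finset (Orb (FermionTorus 2 L)) => f s.card) := by
  ext s s'
  rw [diagonal_mul, mul_diagonal]
  by_cases h : (hubbardTorusWith 2 L 1 U μ - ((g / (L : ℝ) ^ 2 : ℝ) : ℂ) •
      ((pairField dWaveFormFactor L)ᴴ * pairField dWaveFormFactor L)) s s' = 0
  · rw [h, mul_zero, zero_mul]
  · obtain ⟨h1, h2⟩ := tw_preservesSectors_seededGC L U μ g s s' h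
    rw [card_eq_upPart_add_downPart s, card_eq_upPart_add_downPart s', h1, h2, mul_comm]

/-- **`μ`-tilt of the Gibbs weight.** `e^{−βK_L(μ')} = e^{−βK_L(μ)} · diagonal (e^{β(μ'−μ)|s|})`
(`K_L(μ') = K_L(μ) − (μ'−μ)N̂`, `[K_L(μ), N̂] = 0`, `N̂ = diagonal |s|`). [folklore] -/
private theorem gibbsWeight_seededGC_tilt (U g β μ μ' : ℝ) :
    gibbsWeight β (hubbardTorusWith 2 L 1 U μ' - ((g / (L : ℝ) ^ 2 : ℝ) : ℂ) •
        ((pairField dWaveFormFactor L)ᴴ * pairField dWaveFormFactor L)) =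
      gibbsWeight β (hubbardTorusWith 2 L 1 U μ - ((g / (L : ℝ) ^ 2 : ℝ) : ℂ) •
          ((pairField dWaveFormFactor L)ᴴ * pairField dWaveFormFactor L)) *
        diagonal (fun s : Finset (Orb (FermionTorus 2 L)) =>
          Complex.exp ((β * (μ' - μ) * (s.card : ℝ) : ℝ) : ℂ)) := by
  have hK : hubbardTorusWith 2 L 1 U μ' - ((g / (L : ℝ) ^ 2 : ℝ) : ℂ) •
      ((pairField dWaveFormFactor L)ᴴ * pairField dWaveFormFactor L) =
      (hubbardTorusWith 2 L 1 U μ - ((g / (L : ℝ) ^ 2 : ℝ) : ℂ) •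
        ((pairField dWaveFormFactor L)ᴴ * pairField dWaveFormFactor L)) +
        (-((μ' - μ : ℝ) : ℂ)) • diagonal (fun s : Finset (Orb (FermionTorus 2 L)) => (s.card : ℂ)) := by
    rw [← totalNumber_torus_eq_diagonal, hubbardTorusWith_eq, hubbardTorusWith_eq, Complex.ofReal_sub,
      neg_smul, sub_smul]
    abel
  have hsmul : -(β : ℂ) • (hubbardTorusWith 2 L 1 U μ' - ((g / (L : ℝ) ^ 2 : ℝ) : ℂ) •
      ((pairField dWaveFormFactor L)ᴴ * pairField dWaveFormFactor L)) =
      -(β : ℂ) • (hubbardTorusWith 2 L 1 U μ - ((g / (L : ℝ) ^ 2 : ℝ) : ℂ) •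
        ((pairField dWaveFormFactor L)ᴴ * pairField dWaveFormFactor L)) +
        diagonal (fun s : Finset (Orb (FermionTorus 2 L)) =>
          (((β * (μ' - μ) * (s.card : ℝ) : ℝ)) : ℂ)) := by
    rw [hK, smul_add, smul_smul, ← diagonal_smul]
    congr 2
    funext s
    simp only [Pi.smul_apply, smul_eq_mul]
    push_cast
    ring
  have hcomm : Commute (-(β : ℂ) • (hubbardTorusWith 2 L 1 U μ - ((g / (L : ℝ) ^ 2 : ℝ) : ℂ) •
      ((pairField dWaveFormFactor L)ᴴ * pairField dWaveFormFactor L)))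
      (diagonal (fun s : Finset (Orb (FermionTorus 2 L)) =>
        (((β * (μ' - μ) * (s.card : ℝ) : ℝ)) : ℂ))) := by
    have h := diagonal_card_mul_seededGC L U μ g (fun k => (((β * (μ' - μ) * (k : ℝ) : ℝ)) : ℂ))
    exact (show Commute _ _ from h.symm).smul_left _
  rw [gibbsWeight, gibbsWeight, hsmul, Matrix.exp_add_of_commute _ _ hcomm, Matrix.exp_diagonal]
  congr 2
  funext s
  rw [Pi.exp_def, Complex.exp_eq_exp_ℂ]

/-- (b) **`μ`-tilt of the sector weights**: `W_L(N; β, μ') = e^{β(μ'−μ)N} W_L(N; β, μ)`. [folklore] -/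
private theorem sectorWeight_tilt (U g β μ μ' : ℝ) (N : ℕ) :
    ∑ s ∈ (Finset.univ.filter fun s : Finset (Orb (FermionTorus 2 L)) => s.card = N),
        (Matrix.gibbsWeight β (hubbardTorusWith 2 L 1 U μ' - ((g / (L : ℝ) ^ 2 : ℝ) : ℂ) •
          ((pairField dWaveFormFactor L)ᴴ * pairField dWaveFormFactor L)) s s).re =
      Real.exp (β * (μ' - μ) * N) *
        ∑ s ∈ (Finset.univ.filter fun s : Finset (Orb (FermionTorus 2 L)) => s.card = N),
          (Matrix.gibbsWeight β (hubbardTorusWith 2 L 1 U μ - ((g / (L : ℝ) ^ 2 : ℝ) : ℂ) •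
            ((pairField dWaveFormFactor L)ᴴ * pairField dWaveFormFactor L)) s s).re := by
  rw [gibbsWeight_seededGC_tilt L U g β μ μ', Finset.mul_sum]
  refine Finset.sum_congr rfl fun s hs => ?_
  have hN : (s.card : ℝ) = N := by exact_mod_cast (Finset.mem_filter.1 hs).2
  rw [mul_diagonal, ← Complex.ofReal_exp, Complex.re_mul_ofReal, hN, mul_comm]

/-- (a) **Sector decomposition of the partition function**: `Re Z = Σ_{N ≤ 2L²} W_L(N)` (trace in the
occupation basis, regrouped by `|s| ≤ |Orb Λ_L| = 2L²`). [folklore] -/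
private theorem re_partitionFn_eq_sum_sectorWeight (U g β μ : ℝ) :
    (Matrix.partitionFn β (hubbardTorusWith 2 L 1 U μ - ((g / (L : ℝ) ^ 2 : ℝ) : ℂ) •
        ((pairField dWaveFormFactor L)ᴴ * pairField dWaveFormFactor L))).re =
      ∑ N ∈ Finset.range (2 * L ^ 2 + 1),
        ∑ s ∈ (Finset.univ.filter fun s : Finset (Orb (FermionTorus 2 L)) => s.card = N),
          (Matrix.gibbsWeight β (hubbardTorusWith 2 L 1 U μ - ((g / (L : ℝ) ^ 2 : ℝ) : ℂ) •
            ((pairField dWaveFormFactor L)ᴴ * pairField dWaveFormFactor L)) s s).re := by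
  rw [Matrix.partitionFn, Matrix.trace, Complex.re_sum]
  simp only [Matrix.diag_apply]
  refine (Finset.sum_fiberwise_of_maps_to (fun s _ => ?_) _).symm
  rw [Finset.mem_range]
  have h := Finset.card_le_univ s
  rw [card_orb_fermionTorus_two] at h
  omega

/-- (c) **Positivity of the sector weights**: `0 < W_L(N; β, μ)` for `N ≤ 2L²` (the diagonal entries of
the positive definite `e^{−βK}` have positive real part; the sector `|s| = N` is nonempty). [folklore] -/
private theorem sectorWeight_pos (U g β μ : ℝ) {N : ℕ} (hN : N ≤ 2 * L ^ 2) :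
    0 < ∑ s ∈ (Finset.univ.filter fun s : Finset (Orb (FermionTorus 2 L)) => s.card = N),
        (Matrix.gibbsWeight β (hubbardTorusWith 2 L 1 U μ - ((g / (L : ℝ) ^ 2 : ℝ) : ℂ) •
          ((pairField dWaveFormFactor L)ᴴ * pairField dWaveFormFactor L)) s s).re := by
  have hpd := posDef_gibbsWeight β (tw_isHermitian_seededGC L U μ g)
  obtain ⟨s₀, -, hs₀⟩ := Finset.exists_subset_card_eq
    (s := (Finset.univ : Finset (Orb (FermionTorus 2 L)))) (n := N)
    (by rwa [Finset.card_univ, card_orb_fermionTorus_two])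
  refine Finset.sum_pos (fun s _ => (Complex.pos_iff.1 hpd.diag_pos).1) ⟨s₀, ?_⟩
  rw [Finset.mem_filter]
  exact ⟨Finset.mem_univ _, hs₀⟩

/-- (d) **Probabilistic normal form of the defect** on the even sectors `N = 2n ≤ 2L²`:
`β(E_V − μN) + log Re Z ≤ L² log 4 + log (Re Z / W_L(N; β, μ))`, `E_V = minEnergyOn Hcan (szSector N 0)`.
[folklore] -/
private theorem defect_normalForm (U g : ℝ) {β : ℝ} (hβ : 0 < β) (μ : ℝ) {n : ℕ} (hn : n ≤ L ^ 2) :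
    β * ((hubbardTorus 2 L 1 U - ((g / (L : ℝ) ^ 2 : ℝ) : ℂ) •
          ((pairField dWaveFormFactor L)ᴴ * pairField dWaveFormFactor L)).minEnergyOn
            (szSector (Λ := FermionTorus 2 L) (2 * n) 0) - μ * ((2 * n : ℕ) : ℝ)) +
      Real.log (Matrix.partitionFn β (hubbardTorusWith 2 L 1 U μ - ((g / (L : ℝ) ^ 2 : ℝ) : ℂ) •
        ((pairField dWaveFormFactor L)ᴴ * pairField dWaveFormFactor L))).re ≤
    (L : ℝ) ^ 2 * Real.log 4 +
      Real.log ((Matrix.partitionFn β (hubbardTorusWith 2 L 1 U μ - ((g / (L : ℝ) ^ 2 : ℝ) : ℂ) •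
          ((pairField dWaveFormFactor L)ᴴ * pairField dWaveFormFactor L))).re /
        ∑ s ∈ (Finset.univ.filter fun s : Finset (Orb (FermionTorus 2 L)) => s.card = 2 * n),
          (Matrix.gibbsWeight β (hubbardTorusWith 2 L 1 U μ - ((g / (L : ℝ) ^ 2 : ℝ) : ℂ) •
            ((pairField dWaveFormFactor L)ᴴ * pairField dWaveFormFactor L)) s s).re) := by
  set K := hubbardTorusWith 2 L 1 U μ - ((g / (L : ℝ) ^ 2 : ℝ) : ℂ) •
    ((pairField dWaveFormFactor L)ᴴ * pairField dWaveFormFactor L) with hKdef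
  set Hc := hubbardTorus 2 L 1 U - ((g / (L : ℝ) ^ 2 : ℝ) : ℂ) •
    ((pairField dWaveFormFactor L)ᴴ * pairField dWaveFormFactor L) with hHcdef
  set V : Submodule ℂ (Fock (Orb (FermionTorus 2 L))) :=
    nParticleSubmodule (ι := Orb (FermionTorus 2 L)) (2 * n) with hVdef
  have h2n : 2 * n ≤ 2 * L ^ 2 := by omega
  have hKh : K.IsHermitian := tw_isHermitian_seededGC L U μ g
  have hHc : Hc.IsHermitian :=
    Summit.HubbardSuperconductivity.TwTipContinuation.Negative.seededH_isHermitian U g L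
  -- `K = Hc − μN̂`, `[K, N̂] = 0`, so `K` leaves the `2n`-particle sector invariant
  have heq : K = Hc - (μ : ℂ) • totalNumber := by
    rw [hKdef, hHcdef, hubbardTorusWith_eq]
    abel
  have hKN : totalNumber * K = K * totalNumber := by
    rw [totalNumber_torus_eq_diagonal]
    exact diagonal_card_mul_seededGC L U μ g (fun k => (k : ℂ))
  have hinv : ∀ v ∈ V, K *ᵥ v ∈ V := fun v hv =>
    LiebTwo.isNParticle_mulVec_of_commute (N := 2 * n) hv hKN
  -- the sector weight is the trace against the sector projection
  have hW : ((projMatrix (V.map ((WithLp.linearEquiv 2 ℂ (Finset (Orb (FermionTorus 2 L)) → ℂ)).symm :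
      (Finset (Orb (FermionTorus 2 L)) → ℂ) →ₗ[ℂ] EuclideanSpace ℂ (Finset (Orb (FermionTorus 2 L))))) *
        gibbsWeight β K).trace).re =
      ∑ s ∈ (Finset.univ.filter fun s : Finset (Orb (FermionTorus 2 L)) => s.card = 2 * n),
        (Matrix.gibbsWeight β K s s).re := by
    rw [hVdef, projMatrix_nParticleSubmodule L (2 * n), Matrix.trace, Complex.re_sum, Finset.sum_filter]
    refine Finset.sum_congr rfl fun s _ => ?_
    simp only [Matrix.diag_apply, diagonal_mul, ite_mul, one_mul, zero_mul]
    split_ifs <;> simp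
  -- the sector entropy bound of the tree
  have hle := re_trace_projMatrix_mul_gibbsWeight_le hKh V hinv hβ.le
  rw [hW] at hle
  -- the grand-canonical sector energy is the canonical one shifted by `μ·2n`
  have hmin : Hc.minEnergyOn (szSector (Λ := FermionTorus 2 L) (2 * n) 0) - μ * ((2 * n : ℕ) : ℝ) ≤
      K.minEnergyOn V := by
    rw [hHcdef, stub_evenSectorMin stub_pairFieldSinglet L U g (2 * n) (even_two_mul n) h2n, ← hHcdef]
    obtain ⟨s₀, -, hs₀⟩ := Finset.exists_subset_card_eq
      (s := (Finset.univ : Finset (Orb (FermionTorus 2 L)))) (n := 2 * n)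
      (by rwa [Finset.card_univ, card_orb_fermionTorus_two])
    have hunit₀ : star (Pi.single s₀ (1 : ℂ) : Fock (Orb (FermionTorus 2 L))) ⬝ᵥ Pi.single s₀ 1 = 1 := by
      rw [← Pi.single_star, star_one, single_dotProduct, one_mul, Pi.single_eq_same]
    refine le_csInf ⟨_, _, single_mem_nParticleSubmodule L hs₀, hunit₀, rfl⟩ ?_
    rintro E ⟨ψ, hψV, hψ1, rfl⟩
    have hN : IsNParticle (2 * n) ψ := hψV
    have hshift : (star ψ ⬝ᵥ K *ᵥ ψ).re = (star ψ ⬝ᵥ Hc *ᵥ ψ).re - μ * ((2 * n : ℕ) : ℝ) := by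
      rw [heq, sub_mulVec, smul_mulVec, totalNumber_mulVec_of_isNParticle hN, smul_smul,
        dotProduct_sub, dotProduct_smul, hψ1, Complex.sub_re]
      simp
    rw [hshift]
    have h := minEnergyOn_le_rayleigh_of_mem hHc V hψV hψ1
    linarith
  -- `dim V ≤ |Fock| = 4^{L²}`
  have hdim : (Module.finrank ℂ V : ℝ) ≤ (4 : ℝ) ^ (L ^ 2) := by
    have h := Submodule.finrank_le V
    rw [Module.finrank_pi ℂ, Fintype.card_finset, card_orb_fermionTorus_two, pow_mul,
      show (2 : ℕ) ^ 2 = 4 by norm_num] at h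
    exact_mod_cast h
  -- positivity of `W` and `Z`
  have hWpos := sectorWeight_pos L U g β μ h2n
  have hZpos : 0 < (Matrix.partitionFn β K).re :=
    lt_of_lt_of_le (Real.exp_pos _) (exp_neg_mul_groundEnergy_le_partitionFn hKh β)
  -- logarithms
  have hlogW : Real.log (∑ s ∈ (Finset.univ.filter fun s : Finset (Orb (FermionTorus 2 L)) => s.card = 2 * n),
      (Matrix.gibbsWeight β K s s).re) ≤ (L : ℝ) ^ 2 * Real.log 4 + -(β * K.minEnergyOn V) := by
    have h4 : (0 : ℝ) < (4 : ℝ) ^ (L ^ 2) := by positivity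
    have hW4 := hle.trans (mul_le_mul_of_nonneg_right hdim (Real.exp_pos _).le)
    have h := Real.log_le_log hWpos hW4
    rw [Real.log_mul h4.ne' (Real.exp_pos _).ne', Real.log_exp, Real.log_pow, Nat.cast_pow] at h
    exact h
  have hβm : β * (Hc.minEnergyOn (szSector (Λ := FermionTorus 2 L) (2 * n) 0) - μ * ((2 * n : ℕ) : ℝ)) ≤
      β * K.minEnergyOn V := mul_le_mul_of_nonneg_left hmin hβ.le
  rw [Real.log_div hZpos.ne' hWpos.ne']
  linarith

end Helpers

/-- **SECTOR-WEIGHT BASICS** for the seeded grand-canonical torus `K_L(μ) = hubbardTorusWith 2 L 1 U μ − (g/L²)P_L`: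
(a) the partition function is the sum of the particle-number sector weights `W_L(N; β, μ)`, `N = 0,…,2L²`
(trace in the occupation basis, regrouped by `|s|`); (b) the `μ`-TILT `W_L(N; β, μ') = e^{β(μ'−μ)N} W_L(N; β, μ)`
(`K_L(μ') = K_L(μ) − (μ'−μ)N̂`, `[K_L, N̂] = 0`, `N̂` diagonal); (c) positivity (diagonal entries of the positive
definite `e^{−βK}`, nonempty sectors); (d) the PROBABILISTIC NORMAL FORM of the defect for even sectors
`N = 2n ≤ 2L²`: `β(E_V − μN) + log Re Z ≤ L² log 4 + log (Re Z / W_L(N; β, μ))`, `E_V = minEnergyOn Hcan (szSector N 0)`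
(tree `re_trace_projMatrix_mul_gibbsWeight_le` with `K = nParticleSubmodule N`, the orthogonal projection onto which is
the diagonal indicator of `|s| = N`; `minEnergyOn (K_L μ) ≥ minEnergyOn Hcan − μN` on that sector; landed
`stub_evenSectorMin` + `stub_pairFieldSinglet`; `dim ≤ 4^{L²}`). Bratteli–Robinson II §5.3.1. [folklore] -/
theorem stub_sectorWeightBasics :
    ∀ (L : ℕ) [NeZero L] (U g β : ℝ), 0 < β →
      (∀ μ : ℝ,
        (Matrix.partitionFn β (hubbardTorusWith 2 L 1 U μ - ((g / (L : ℝ) ^ 2 : ℝ) : ℂ) •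
          ((pairField dWaveFormFactor L)ᴴ * pairField dWaveFormFactor L))).re =
        ∑ N ∈ Finset.range (2 * L ^ 2 + 1),
          ∑ s ∈ (Finset.univ.filter fun s : Finset (Orb (FermionTorus 2 L)) => s.card = N),
            (Matrix.gibbsWeight β (hubbardTorusWith 2 L 1 U μ - ((g / (L : ℝ) ^ 2 : ℝ) : ℂ) •
              ((pairField dWaveFormFactor L)ᴴ * pairField dWaveFormFactor L)) s s).re) ∧
      (∀ (μ μ' : ℝ) (N : ℕ),
        ∑ s ∈ (Finset.univ.filter fun s : Finset (Orb (FermionTorus 2 L)) => s.card = N),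
            (Matrix.gibbsWeight β (hubbardTorusWith 2 L 1 U μ' - ((g / (L : ℝ) ^ 2 : ℝ) : ℂ) •
              ((pairField dWaveFormFactor L)ᴴ * pairField dWaveFormFactor L)) s s).re =
        Real.exp (β * (μ' - μ) * N) *
          ∑ s ∈ (Finset.univ.filter fun s : Finset (Orb (FermionTorus 2 L)) => s.card = N),
            (Matrix.gibbsWeight β (hubbardTorusWith 2 L 1 U μ - ((g / (L : ℝ) ^ 2 : ℝ) : ℂ) •
              ((pairField dWaveFormFactor L)ᴴ * pairField dWaveFormFactor L)) s s).re) ∧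
      (∀ (μ : ℝ) (N : ℕ), N ≤ 2 * L ^ 2 →
        0 < ∑ s ∈ (Finset.univ.filter fun s : Finset (Orb (FermionTorus 2 L)) => s.card = N),
            (Matrix.gibbsWeight β (hubbardTorusWith 2 L 1 U μ - ((g / (L : ℝ) ^ 2 : ℝ) : ℂ) •
              ((pairField dWaveFormFactor L)ᴴ * pairField dWaveFormFactor L)) s s).re) ∧
      (∀ (μ : ℝ) (n : ℕ), n ≤ L ^ 2 →
        β * ((hubbardTorus 2 L 1 U - ((g / (L : ℝ) ^ 2 : ℝ) : ℂ) •
              ((pairField dWaveFormFactor L)ᴴ * pairField dWaveFormFactor L)).minEnergyOn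
                (szSector (Λ := FermionTorus 2 L) (2 * n) 0) - μ * ((2 * n : ℕ) : ℝ)) +
          Real.log (Matrix.partitionFn β (hubbardTorusWith 2 L 1 U μ - ((g / (L : ℝ) ^ 2 : ℝ) : ℂ) •
            ((pairField dWaveFormFactor L)ᴴ * pairField dWaveFormFactor L))).re ≤
        (L : ℝ) ^ 2 * Real.log 4 +
          Real.log ((Matrix.partitionFn β (hubbardTorusWith 2 L 1 U μ - ((g / (L : ℝ) ^ 2 : ℝ) : ℂ) •
              ((pairField dWaveFormFactor L)ᴴ * pairField dWaveFormFactor L))).re /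
            ∑ s ∈ (Finset.univ.filter fun s : Finset (Orb (FermionTorus 2 L)) => s.card = 2 * n),
              (Matrix.gibbsWeight β (hubbardTorusWith 2 L 1 U μ - ((g / (L : ℝ) ^ 2 : ℝ) : ℂ) •
                ((pairField dWaveFormFactor L)ᴴ * pairField dWaveFormFactor L)) s s).re)) := by
  intro L _ U g β hβ
  exact ⟨fun μ => re_partitionFn_eq_sum_sectorWeight L U g β μ,
    fun μ μ' N => sectorWeight_tilt L U g β μ μ' N,
    fun μ _ hN => sectorWeight_pos L U g β μ hN,
    fun μ _ hn => defect_normalForm L U g hβ μ hn⟩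

end

end Summit.HubbardSuperconductivity.HubbardSuperconductivity.Theorems.TwSeededEnsembleEquivalence.ThermalDuality
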